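import Literature.MathematicalPhysics.QuantumLattice.StabilityFlowBoundProofs
import Literature.MathematicalPhysics.QuantumLattice.SmoothingLocalityProofs
import HarnessLib

/-!
# Power-law quasi-locality of the spectral flow (MZ13 Lemma 2, two-scale optimisation)

Top-down layer (seat B) of the formalisation of the Michalakis–Zwolak stability theorem
(hubbard.S19, `Literature.MathematicalPhysics.QuantumLattice.michalakis_zwolak`). The generator of
Hastings' flow is a quasi-local interaction: its size-weighted local norm is `≤ a J` (`a = |ε|`)
and, at every splitting scale `θ`, the terms of diameter `> 2θ` have local norm
`≤ a K/(θ+1)^{2p}`. The flow Lieb–Robinson bound with the coupling extracted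
(`norm_comm_flow_le_exp_weighted_scaled`), the torus grading of range `2θ`
(`TorusLiebRobinsonProofs`) and the choice `θ = ⌊√ℓ⌋/2`, `μ = 1` give MZ13 Lemma 2 in commutator
and in tail form (`norm_comm_flow_le_pow`, `norm_flow_sub_twirl_le_pow`): for `A ∈ 𝔄_{b_x(R₁)}`
and `B` supported outside `b_x(R₁+ℓ)`, `t ∈ [0, T]`, `T ≤ 1`,
`‖[α_t(A), B]‖ ≤ 2‖A‖‖B‖ |b_x(R₁)| a E_p/(ℓ+1)^p`,
`E_p = e^{2eJ}(2p)! 9^p + K 4^p e^{2J}` — arXiv:1109.1588 p. 12, "`‖𝓤(r'; O_u(r))‖ ≤ J‖O_u(r)‖g(r')`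
for a rapidly decaying `g`". No definitions, no named facts (theorems only).
-/

noncomputable section

open Matrix Complex Set Filter MeasureTheory
open scoped Nat
open scoped Matrix Matrix.Norms.L2Operator

namespace Literature.MathematicalPhysics.QuantumLattice

open Literature.Probability.LatticeModels

/-! ### Integer arithmetic of the splitting scale `θ = ⌊√ℓ⌋/2` -/

/-- With `n = ⌊√ℓ⌋`, `θ = n/2` and `m = max 1 (n−1)`: `2θ ≤ ℓ`, `ℓ + 1 ≤ 9 m²`,
`ℓ + 1 ≤ 4 (θ+1)²` and `m ≤ (ℓ+1)/(2θ+1)`. [folklore] -/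
theorem sqrt_scale_arith (ℓ : ℕ) :
    2 * (Nat.sqrt ℓ / 2) ≤ ℓ ∧
    ℓ + 1 ≤ 9 * (max 1 (Nat.sqrt ℓ - 1)) ^ 2 ∧
    ℓ + 1 ≤ 4 * (Nat.sqrt ℓ / 2 + 1) ^ 2 ∧
    max 1 (Nat.sqrt ℓ - 1) ≤ (ℓ + 1) / (2 * (Nat.sqrt ℓ / 2) + 1) := by
  set n := Nat.sqrt ℓ with hn
  have h1 : n * n ≤ ℓ := Nat.sqrt_le ℓ
  have h2 : ℓ < (n + 1) * (n + 1) := Nat.lt_succ_sqrt ℓ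
  have h3 : n ≤ ℓ := Nat.sqrt_le_self ℓ
  have hθ : 2 * (n / 2) ≤ n := Nat.mul_div_le n 2
  have hθ' : n ≤ 2 * (n / 2) + 1 := by omega
  refine ⟨hθ.trans h3, ?_, ?_, ?_⟩
  · rcases le_or_gt n 1 with h | h
    · have : max 1 (n - 1) = 1 := by omega
      rw [this]; nlinarith
    · have : max 1 (n - 1) = n - 1 := by omega
      rw [this]
      have h4 : n + 1 ≤ 3 * (n - 1) := by omega
      nlinarith
  · nlinarith
  · rw [Nat.le_div_iff_mul_le (by omega)]
    rcases le_or_gt n 1 with h | h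
    · have : max 1 (n - 1) = 1 := by omega
      rw [this]; omega
    · have : max 1 (n - 1) = n - 1 := by omega
      rw [this]
      obtain ⟨k, hk⟩ : ∃ k, n = k + 1 := ⟨n - 1, by omega⟩
      have hk' : n - 1 = k := by omega
      rw [hk']
      have h5 : k * (k + 2) ≤ (k + 1) * (k + 1) := by nlinarith
      calc k * (2 * (n / 2) + 1) ≤ k * (k + 2) := Nat.mul_le_mul_left _ (by omega)
        _ ≤ (k + 1) * (k + 1) := h5
        _ = n * n := by rw [hk]
        _ ≤ ℓ + 1 := by omega

section Torus

open Finset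

variable {d L : ℕ} [NeZero L] {κ : Type*} [Fintype κ] [DecidableEq κ] {q : ℕ}

/-- **MZ13 Lemma 2 in commutator form: power-law quasi-locality of the flow of a quasi-local
generator with small coupling.** Let `Ψ_t` be local interactions on the decorated torus,
continuous on `[0, T]` (`T ≤ 1`), generating the unitary flow `U` (`U(0) = 1`, `∂_t U = i H(Ψ_t) U`),
with size-weighted local norms `≤ a J` (`0 ≤ a ≤ 1 ≤ J`) and, at every scale `θ`, long-range part
(terms of diameter `> 2θ`) of local norm `≤ a K/(θ+1)^{2p}`. Then for `A ∈ 𝔄_{b_x(R₁)}`, `B`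
supported on `Y` disjoint from `b_x(R₁ + ℓ)` and `t ∈ [0, T]`:
`‖[U(t)ᴴ A U(t), B]‖ ≤ 2‖A‖‖B‖ |b_x(R₁)| a (e^{2eJ}(2p)! 9^p + K 4^p e^{2J})/(ℓ+1)^p`.
[cite: MichalakisZwolakCMP2013, §5.2 Lemma 2 (arXiv:1109.1588 p. 12)] -/
theorem norm_comm_flow_le_pow {Ψ : ℝ → Interaction (TorusSite d L × κ) q}
    (hΨ : ∀ t, (Ψ t).IsLocal) {T : ℝ} (hT1 : T ≤ 1)
    (hΨc : ∀ Z, ContinuousOn (fun t => Ψ t Z) (Icc 0 T)) {U : ℝ → Op (TorusSite d L × κ) q}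
    (hU0 : U 0 = 1)
    (hU : ∀ t ∈ Icc 0 T,
      HasDerivWithinAt U (((I : ℂ) • localHamiltonian (Ψ t) univ) * U t) (Icc 0 T) t)
    (hU1 : ∀ t ∈ Icc 0 T, (U t)ᴴ * U t = 1) (hU2 : ∀ t ∈ Icc 0 T, U t * (U t)ᴴ = 1)
    {J a : ℝ} (hJ1 : 1 ≤ J) (ha0 : 0 ≤ a) (ha1 : a ≤ 1)
    (hJ : ∀ t ∈ Icc 0 T, ∀ y : TorusSite d L × κ,
      ∑ Z ∈ univ.filter (fun Z : Finset (TorusSite d L × κ) => y ∈ Z), (#Z : ℝ) * ‖Ψ t Z‖ ≤ a * J)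
    {K : ℝ} {p : ℕ} (hK0 : 0 ≤ K)
    (hK : ∀ θ : ℕ, ∀ t ∈ Icc 0 T, ∀ y : TorusSite d L × κ,
      ∑ Z ∈ univ.filter (fun Z : Finset (TorusSite d L × κ) => y ∈ Z),
        ‖(if torusDiam Z ≤ 2 * θ then (0 : Op (TorusSite d L × κ) q) else Ψ t Z)‖ ≤
        a * (K / ((θ : ℝ) + 1) ^ (2 * p)))
    (x : TorusSite d L) {R₁ ℓ : ℕ} {A B : Op (TorusSite d L × κ) q}
    (hA : IsSupportedOn A (cellBall x R₁)) {Y : Finset (TorusSite d L × κ)}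
    (hY : Disjoint (cellBall x (R₁ + ℓ)) Y) (hB : IsSupportedOn B Y) {t : ℝ} (ht : t ∈ Icc 0 T) :
    ‖(U t)ᴴ * A * U t * B - B * ((U t)ᴴ * A * U t)‖ ≤
      2 * ‖A‖ * ‖B‖ * #(cellBall x R₁ : Finset (TorusSite d L × κ)) * a *
        ((Real.exp (2 * Real.exp 1 * J) * (2 * p)! * 9 ^ p + K * 4 ^ p * Real.exp (2 * J)) /
          ((ℓ : ℝ) + 1) ^ p) := by
  obtain ⟨hθℓ, hm9, hθ4, hmδ⟩ := sqrt_scale_arith ℓ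
  set n : ℕ := Nat.sqrt ℓ with hn
  set θ : ℕ := n / 2 with hθ
  set m : ℕ := max 1 (n - 1) with hm
  have hm1 : 1 ≤ m := le_max_left _ _
  have hJ0 : 0 < J := lt_of_lt_of_le one_pos hJ1
  -- the grading of range `2θ`
  set δ : Finset (TorusSite d L × κ) → ℕ := fun Z =>
    (R₁ + ℓ + 1 - Z.sup fun z => torusDist x z.1) / (2 * θ + 1) with hδdef
  have hδY : ∀ Z, 0 < δ Z → Disjoint Z Y := fun Z hZ => disjoint_of_grading_pos x R₁ ℓ (2 * θ) hZ hY
  have hδstep : ∀ Z Z' : Finset (TorusSite d L × κ), torusDiam Z' ≤ 2 * θ → ¬ Disjoint Z' Z →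
      δ Z ≤ δ Z' + 1 := fun Z Z' hZ' hZZ' => grading_le_grading_add_one x R₁ ℓ (2 * θ) hZ' hZZ'
  have hXδ : m ≤ δ (cellBall x R₁) :=
    hmδ.trans (div_le_grading_cellBall (κ := κ) x R₁ ℓ (2 * θ))
  have hX : 0 < δ (cellBall x R₁) := lt_of_lt_of_le hm1 hXδ
  -- the long-range coupling at scale `θ`
  set κ' : ℝ := K / (((θ : ℝ) + 1) ^ (2 * p) * J) with hκ'
  have hκ'0 : 0 ≤ κ' := by positivity
  have hJ'' : ∀ s ∈ Icc 0 T, ∀ y : TorusSite d L × κ,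
      ∑ Z ∈ univ.filter (fun Z : Finset (TorusSite d L × κ) => y ∈ Z),
        ‖(if torusDiam Z ≤ 2 * θ then (0 : Op (TorusSite d L × κ) q) else Ψ s Z)‖ ≤ κ' * (a * J) := by
    intro s hs y
    refine (hK θ s hs y).trans (le_of_eq ?_)
    rw [hκ']; field_simp
  have hmain := norm_comm_flow_le_exp_weighted_scaled hΨ hΨc hU0 hU hU1 hU2
    (R := fun Z : Finset (TorusSite d L × κ) => torusDiam Z ≤ 2 * θ) hA hB δ hδY hδstep hX
    hJ0.le ha0 ha1 hJ hκ'0 hJ'' zero_le_one ht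
  refine hmain.trans ?_
  have hpre : 0 ≤ 2 * ‖A‖ * ‖B‖ * (#(cellBall x R₁ : Finset (TorusSite d L × κ)) : ℝ) * a := by
    positivity
  refine mul_le_mul_of_nonneg_left ?_ hpre
  have hℓ1 : (0 : ℝ) < (ℓ : ℝ) + 1 := by positivity
  have ht0 : 0 ≤ t := ht.1
  have ht1 : t ≤ 1 := ht.2.trans hT1
  -- first term: `exp(−δX + 2eJt) ≤ e^{2eJ} (2p)!/m^{2p} ≤ e^{2eJ} (2p)! 9^p/(ℓ+1)^p`
  have hmr : (0 : ℝ) < m := by exact_mod_cast hm1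
  have h1 : Real.exp (-(1 * (δ (cellBall x R₁) : ℕ)) + 2 * Real.exp 1 * J * t) ≤
      Real.exp (2 * Real.exp 1 * J) * (2 * p)! * 9 ^ p / ((ℓ : ℝ) + 1) ^ p := by
    have e1 : Real.exp (-(1 * (δ (cellBall x R₁) : ℕ)) + 2 * Real.exp 1 * J * t) ≤
        Real.exp (-(m : ℝ)) * Real.exp (2 * Real.exp 1 * J) := by
      rw [← Real.exp_add]
      refine Real.exp_le_exp.mpr ?_
      have : (m : ℝ) ≤ (δ (cellBall x R₁) : ℕ) := by exact_mod_cast hXδ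
      have : 2 * Real.exp 1 * J * t ≤ 2 * Real.exp 1 * J := by
        have : 0 ≤ 2 * Real.exp 1 * J := by positivity
        nlinarith
      linarith
    have e2 : Real.exp (-(m : ℝ)) ≤ ((2 * p)! : ℝ) / (m : ℝ) ^ (2 * p) :=
      exp_neg_le_factorial_div_pow hmr (2 * p)
    have e3 : ((2 * p)! : ℝ) / (m : ℝ) ^ (2 * p) ≤ (2 * p)! * 9 ^ p / ((ℓ : ℝ) + 1) ^ p := by
      rw [div_le_div_iff₀ (pow_pos hmr _) (pow_pos hℓ1 p)]
      have h9 : ((ℓ : ℝ) + 1) ^ p ≤ (9 : ℝ) ^ p * (m : ℝ) ^ (2 * p) := by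
        rw [pow_mul, ← mul_pow]
        refine pow_le_pow_left₀ hℓ1.le ?_ p
        exact_mod_cast hm9
      calc ((2 * p)! : ℝ) * ((ℓ : ℝ) + 1) ^ p ≤ (2 * p)! * ((9 : ℝ) ^ p * (m : ℝ) ^ (2 * p)) :=
            mul_le_mul_of_nonneg_left h9 (by positivity)
        _ = (2 * p)! * 9 ^ p * (m : ℝ) ^ (2 * p) := by ring
    calc Real.exp (-(1 * (δ (cellBall x R₁) : ℕ)) + 2 * Real.exp 1 * J * t)
        ≤ Real.exp (-(m : ℝ)) * Real.exp (2 * Real.exp 1 * J) := e1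
      _ ≤ ((2 * p)! * 9 ^ p / ((ℓ : ℝ) + 1) ^ p) * Real.exp (2 * Real.exp 1 * J) :=
          mul_le_mul_of_nonneg_right (e2.trans e3) (Real.exp_pos _).le
      _ = _ := by ring
  -- second term: `κ' e^{2Jt} ≤ K e^{2J}/(θ+1)^{2p} ≤ K 4^p e^{2J}/(ℓ+1)^p`
  have h2 : κ' * Real.exp (2 * J * t) ≤ K * 4 ^ p * Real.exp (2 * J) / ((ℓ : ℝ) + 1) ^ p := by
    have hθ1 : (0 : ℝ) < (θ : ℝ) + 1 := by positivity
    have e1 : Real.exp (2 * J * t) ≤ Real.exp (2 * J) :=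
      Real.exp_le_exp.mpr (by nlinarith)
    have e2 : κ' ≤ K / ((θ : ℝ) + 1) ^ (2 * p) := by
      rw [hκ', div_le_div_iff₀ (by positivity) (pow_pos hθ1 _)]
      calc K * ((θ : ℝ) + 1) ^ (2 * p) = K * (((θ : ℝ) + 1) ^ (2 * p) * 1) := by ring
        _ ≤ K * (((θ : ℝ) + 1) ^ (2 * p) * J) := by gcongr
    have e3 : K / ((θ : ℝ) + 1) ^ (2 * p) ≤ K * 4 ^ p / ((ℓ : ℝ) + 1) ^ p := by
      rw [div_le_div_iff₀ (pow_pos hθ1 _) (pow_pos hℓ1 p)]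
      have h4 : ((ℓ : ℝ) + 1) ^ p ≤ (4 : ℝ) ^ p * ((θ : ℝ) + 1) ^ (2 * p) := by
        rw [pow_mul, ← mul_pow]
        refine pow_le_pow_left₀ hℓ1.le ?_ p
        exact_mod_cast hθ4
      calc K * ((ℓ : ℝ) + 1) ^ p ≤ K * ((4 : ℝ) ^ p * ((θ : ℝ) + 1) ^ (2 * p)) :=
            mul_le_mul_of_nonneg_left h4 hK0
        _ = K * 4 ^ p * ((θ : ℝ) + 1) ^ (2 * p) := by ring
    calc κ' * Real.exp (2 * J * t) ≤ (K * 4 ^ p / ((ℓ : ℝ) + 1) ^ p) * Real.exp (2 * J) :=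
          mul_le_mul (e2.trans e3) e1 (Real.exp_pos _).le (by positivity)
      _ = _ := by ring
  calc Real.exp (-(1 * (δ (cellBall x R₁) : ℕ)) + 2 * Real.exp 1 * J * t) + κ' * Real.exp (2 * J * t)
      ≤ Real.exp (2 * Real.exp 1 * J) * (2 * p)! * 9 ^ p / ((ℓ : ℝ) + 1) ^ p +
        K * 4 ^ p * Real.exp (2 * J) / ((ℓ : ℝ) + 1) ^ p := add_le_add h1 h2
    _ = _ := by ring

/-- **MZ13 Lemma 2 in tail form.** Under the hypotheses of `norm_comm_flow_le_pow`, the rotated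
observable `α_t(A) = U(t)ᴴ A U(t)` of `A ∈ 𝔄_{b_x(R₁)}` is within
`2‖A‖ |b_x(R₁)| a E_p/(ℓ+1)^p` of its localisation `𝔼_{b_x(R₁+ℓ)ᶜ}(α_t(A)) ∈ 𝔄_{b_x(R₁+ℓ)}`.
[cite: MichalakisZwolakCMP2013, §5.2 Lemma 2 (arXiv:1109.1588 p. 12)] -/
theorem norm_flow_sub_twirl_le_pow {Ψ : ℝ → Interaction (TorusSite d L × κ) q}
    (hΨ : ∀ t, (Ψ t).IsLocal) {T : ℝ} (hT1 : T ≤ 1)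
    (hΨc : ∀ Z, ContinuousOn (fun t => Ψ t Z) (Icc 0 T)) {U : ℝ → Op (TorusSite d L × κ) q}
    (hU0 : U 0 = 1)
    (hU : ∀ t ∈ Icc 0 T,
      HasDerivWithinAt U (((I : ℂ) • localHamiltonian (Ψ t) univ) * U t) (Icc 0 T) t)
    (hU1 : ∀ t ∈ Icc 0 T, (U t)ᴴ * U t = 1) (hU2 : ∀ t ∈ Icc 0 T, U t * (U t)ᴴ = 1)
    {J a : ℝ} (hJ1 : 1 ≤ J) (ha0 : 0 ≤ a) (ha1 : a ≤ 1)
    (hJ : ∀ t ∈ Icc 0 T, ∀ y : TorusSite d L × κ,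
      ∑ Z ∈ univ.filter (fun Z : Finset (TorusSite d L × κ) => y ∈ Z), (#Z : ℝ) * ‖Ψ t Z‖ ≤ a * J)
    {K : ℝ} {p : ℕ} (hK0 : 0 ≤ K)
    (hK : ∀ θ : ℕ, ∀ t ∈ Icc 0 T, ∀ y : TorusSite d L × κ,
      ∑ Z ∈ univ.filter (fun Z : Finset (TorusSite d L × κ) => y ∈ Z),
        ‖(if torusDiam Z ≤ 2 * θ then (0 : Op (TorusSite d L × κ) q) else Ψ t Z)‖ ≤
        a * (K / ((θ : ℝ) + 1) ^ (2 * p)))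
    (x : TorusSite d L) {R₁ : ℕ} {A : Op (TorusSite d L × κ) q}
    (hA : IsSupportedOn A (cellBall x R₁)) {t : ℝ} (ht : t ∈ Icc 0 T) (ℓ : ℕ) :
    ‖(U t)ᴴ * A * U t - twirl (cellBall x (R₁ + ℓ) : Finset (TorusSite d L × κ))ᶜ
        ((U t)ᴴ * A * U t)‖ ≤
      2 * ‖A‖ * #(cellBall x R₁ : Finset (TorusSite d L × κ)) * a *
        ((Real.exp (2 * Real.exp 1 * J) * (2 * p)! * 9 ^ p + K * 4 ^ p * Real.exp (2 * J)) /
          ((ℓ : ℝ) + 1) ^ p) := by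
  refine norm_sub_twirl_le _ _ fun u hu huu => ?_
  have h := norm_comm_flow_le_pow hΨ hT1 hΨc hU0 hU hU1 hU2 hJ1 ha0 ha1 hJ hK0 hK x hA
    (Y := (cellBall x (R₁ + ℓ) : Finset (TorusSite d L × κ))ᶜ) disjoint_compl_right hu ht
  refine h.trans ?_
  have hu1 : ‖u‖ ≤ 1 := by
    rcases subsingleton_or_nontrivial (Op (TorusSite d L × κ) q) with hs | hs
    · rw [Subsingleton.elim u 0, norm_zero]; exact zero_le_one
    · exact (CStarRing.norm_of_mem_unitary huu).le
  have hE : 0 ≤ (Real.exp (2 * Real.exp 1 * J) * (2 * p)! * 9 ^ p + K * 4 ^ p * Real.exp (2 * J)) /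
      ((ℓ : ℝ) + 1) ^ p := by positivity
  calc 2 * ‖A‖ * ‖u‖ * #(cellBall x R₁ : Finset (TorusSite d L × κ)) * a *
        ((Real.exp (2 * Real.exp 1 * J) * (2 * p)! * 9 ^ p + K * 4 ^ p * Real.exp (2 * J)) /
          ((ℓ : ℝ) + 1) ^ p)
      ≤ 2 * ‖A‖ * 1 * #(cellBall x R₁ : Finset (TorusSite d L × κ)) * a *
        ((Real.exp (2 * Real.exp 1 * J) * (2 * p)! * 9 ^ p + K * 4 ^ p * Real.exp (2 * J)) /
          ((ℓ : ℝ) + 1) ^ p) := by gcongr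
    _ = _ := by ring

end Torus

end Literature.MathematicalPhysics.QuantumLattice
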